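import Summits.MatrixMultiplication.MatrixMultiplication.Theorems.LevelGradedCohnUmansLevelOneGL2DesignsParabolaFreeMasks

/-!
# Parabola-free sets of `ℤ_p²`: normal form, the generic exactness theorem, and `α₇ = 10`
(stub `stub_tangencySets` of the crux `LevelOneGL2Designs`, stmt-MatrixMultiplication-14080;
wall-breaker axis 5/12, *parabola lifts over finite fields*, family P2-mod)

Part 2 of the reduction: a non-empty parabola-free `T ⊆ ℤ_p × ℤ_p` is moved by a translation
(largest column through the origin) and a dilation `(x, c) ↦ (u x, η c)`, `η = ±u²` (an
automorphism of the parabola graph; every `η ≠ 0` is available when `p ≡ 3 (mod 4)`) to a NORMAL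
FORM whose column-0 mask is canonical (`exists_normalForm`); then `PFS.topA_false` applies to the
family of column masks, giving the generic `no_parabolaFree` (hypotheses: the per-`p` decidable
table checks, square roots, and search verdicts).  The instance `p = 7` is discharged here by
`decide +kernel` in a few seconds: `stub_parabolaFreeAt_7_not_11`, i.e. **`α₇ = 10`** together with
`stub_parabolaFreeAt_7_10`.  The instance `p = 11` (`α₁₁ = 23`, about six minutes of kernel time
spread over the 109 canonical column-0 sets) is in `…ParabolaFreeExact11*.lean`.
-/

set_option linter.dupNamespace false -- `MatrixMultiplication.MatrixMultiplication` (summit = problem, D-0017)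

namespace Summit.MatrixMultiplication.MatrixMultiplication.Theorems.LevelOneGL2Designs.PFS

open Finset

variable {p : ℕ} [hp : Fact p.Prime]

/-! ## Normal form: translation and dilation -/

/-- parabola-freeness is translation invariant -/
theorem PF_translate {T : Finset (ZMod p × ZMod p)} (hT : PF T) (v : ZMod p × ZMod p) :
    PF (T.image (· + v)) := by
  intro s hs s' hs' h
  rw [Finset.mem_image] at hs hs'
  obtain ⟨t, ht, rfl⟩ := hs
  obtain ⟨t', ht', rfl⟩ := hs'
  simp only [Prod.fst_add, Prod.snd_add] at h ⊢
  rw [hT t ht t' ht' (by linear_combination h)]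

/-- column counts after a translation -/
theorem ccZ_translate (T : Finset (ZMod p × ZMod p)) (v : ZMod p × ZMod p) (b : ZMod p) :
    ccZ (T.image (· + v)) b = ccZ T (b - v.1) := by
  rw [ccZ, ccZ, Finset.filter_image, Finset.card_image_of_injective _ (add_left_injective v)]
  congr 1
  ext t
  simp only [Finset.mem_filter, Prod.fst_add, and_congr_right_iff]
  intro _
  constructor
  · intro h; rw [← h, add_sub_cancel_right]
  · intro h; rw [h, sub_add_cancel]

/-- parabola-freeness is invariant under `(x, c) ↦ (u x, ±u² c)` -/
theorem PF_dilate {T : Finset (ZMod p × ZMod p)} (hT : PF T) {u η : ZMod p}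
    (hη : u ^ 2 = η ∨ -u ^ 2 = η) (hu : u ≠ 0) : PF (T.image (dilate u η)) := by
  intro s hs s' hs' h
  rw [Finset.mem_image] at hs hs'
  obtain ⟨t, ht, rfl⟩ := hs
  obtain ⟨t', ht', rfl⟩ := hs'
  simp only [dilate] at h ⊢
  have hu2 : u ^ 2 ≠ 0 := pow_ne_zero 2 hu
  rcases hη with rfl | rfl
  · have h' : u ^ 2 * ((t'.1 - t.1) ^ 2 - (t.2 - t'.2)) = 0 := by linear_combination h
    rcases mul_eq_zero.1 h' with h' | h'
    · exact absurd h' hu2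
    · rw [hT t ht t' ht' (sub_eq_zero.1 h')]
  · have h' : u ^ 2 * ((t.1 - t'.1) ^ 2 - (t'.2 - t.2)) = 0 := by linear_combination h
    rcases mul_eq_zero.1 h' with h' | h'
    · exact absurd h' hu2
    · rw [hT t' ht' t ht (sub_eq_zero.1 h')]

/-- the dilation is injective for non-zero multipliers -/
theorem dilate_injective {u η : ZMod p} (hu : u ≠ 0) (hη : η ≠ 0) :
    Function.Injective (dilate u η) := by
  intro s t h
  simp only [dilate, Prod.mk.injEq] at h
  exact Prod.ext (mul_left_cancel₀ hu h.1) (mul_left_cancel₀ hη h.2)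

/-- column counts after a dilation -/
theorem ccZ_dilate (T : Finset (ZMod p × ZMod p)) {u η : ZMod p} (hu : u ≠ 0) (hη : η ≠ 0)
    (a : ZMod p) : ccZ (T.image (dilate u η)) (u * a) = ccZ T a := by
  rw [ccZ, ccZ, Finset.filter_image, Finset.card_image_of_injective _ (dilate_injective hu hη)]
  congr 1
  ext t
  simp only [Finset.mem_filter, dilate, and_congr_right_iff]
  intro _
  exact (mul_right_injective₀ hu).eq_iff

/-- the column-0 mask after a dilation is the dilated mask -/
theorem colMask_dilate (T : Finset (ZMod p × ZMod p)) {u : ZMod p} (hu : u ≠ 0) (η : ℕ) :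
    colMask (T.image (dilate u (η : ZMod p))) 0 = dil p η (colMask T 0) := by
  have hp0 : 0 < p := hp.out.pos
  apply Nat.eq_of_testBit_eq
  intro j
  apply Bool.eq_iff_iff.2
  rw [testBit_colMask, testBit_dil, Nat.cast_zero, Finset.mem_image]
  constructor
  · rintro ⟨hj, t, ht, hdt⟩
    simp only [dilate, Prod.mk.injEq, mul_eq_zero, hu, false_or] at hdt
    refine ⟨t.2.val, ZMod.val_lt _, ?_, ?_⟩
    · rw [testBit_colMask, Nat.cast_zero, ZMod.natCast_zmod_val, ← hdt.1]
      exact ⟨ZMod.val_lt _, ht⟩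
    · apply FlagLine.nat_eq_of_cast_eq (Nat.mod_lt _ hp0) hj
      rw [ZMod.natCast_mod, Nat.cast_mul, ZMod.natCast_zmod_val, hdt.2]
  · rintro ⟨i, hi, hbit, hj⟩
    obtain ⟨-, hiT⟩ := (testBit_colMask T 0 i).1 hbit
    rw [Nat.cast_zero] at hiT
    refine ⟨hj ▸ Nat.mod_lt _ hp0, (0, (i : ZMod p)), hiT, ?_⟩
    simp only [dilate, mul_zero, Prod.mk.injEq, true_and]
    rw [← hj, ZMod.natCast_mod, Nat.cast_mul]

/-- **Normal form.**  A non-empty parabola-free set can be moved, preserving its size and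
parabola-freeness, so that `(0,0)` lies in it, column `0` is a largest column, and the column-0
mask is canonical (minimal in its dilation orbit).  Needs square roots of `±η` for every
`η ≠ 0` (true for `p ≡ 3 (mod 4)`; supplied per `p`). -/
theorem exists_normalForm
    (Hsq : ∀ η : ℕ, 1 ≤ η → η < p → ∃ u : ZMod p, u ≠ 0 ∧ (u ^ 2 = η ∨ -u ^ 2 = η))
    {T : Finset (ZMod p × ZMod p)} (hT : PF T) (hne : T.Nonempty) :
    ∃ T₂ : Finset (ZMod p × ZMod p), T₂.card = T.card ∧ PF T₂ ∧ ((0 : ZMod p), (0 : ZMod p)) ∈ T₂ ∧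
      (∀ b, ccZ T₂ b ≤ ccZ T₂ 0) ∧ isCanon p (colMask T₂ 0) = true := by
  have hp0 : 0 < p := hp.out.pos
  have hp2 : 2 ≤ p := hp.out.two_le
  -- a largest column `a₀`, a point `t₀` in it
  obtain ⟨a₀, -, hmax⟩ := Finset.exists_max_image Finset.univ (ccZ T) Finset.univ_nonempty
  obtain ⟨t, ht⟩ := hne
  have h1 : 1 ≤ ccZ T a₀ := by
    refine le_trans ?_ (hmax t.1 (Finset.mem_univ _))
    exact Finset.card_pos.2 ⟨t, Finset.mem_filter.2 ⟨ht, rfl⟩⟩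
  obtain ⟨t₀, ht₀⟩ := Finset.card_pos.1 h1
  rw [Finset.mem_filter] at ht₀
  -- translate `t₀` to the origin
  set T₁ := T.image (· + -t₀) with hT₁
  have hT₁pf : PF T₁ := PF_translate hT _
  have hT₁card : T₁.card = T.card := Finset.card_image_of_injective _ (add_left_injective _)
  have hT₁zero : ((0 : ZMod p), (0 : ZMod p)) ∈ T₁ :=
    Finset.mem_image.2 ⟨t₀, ht₀.1, by rw [add_neg_cancel]; rfl⟩
  have hT₁max : ∀ b, ccZ T₁ b ≤ ccZ T₁ 0 := by
    intro b
    rw [hT₁, ccZ_translate, ccZ_translate, Prod.fst_neg, sub_neg_eq_add, sub_neg_eq_add, zero_add,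
      ht₀.2]
    exact hmax _ (Finset.mem_univ _)
  -- minimise the column-0 mask over the dilation orbit
  set A₀ := colMask T₁ 0 with hA₀
  set orb := (Finset.range (p - 1)).image fun i => dil p (i + 1) A₀ with horb
  have horbne : orb.Nonempty := (Finset.nonempty_range_iff.2 (by omega)).image _
  obtain ⟨i₀, hi₀, hi₀eq⟩ := Finset.mem_image.1 (Finset.min'_mem orb horbne)
  rw [Finset.mem_range] at hi₀
  obtain ⟨u, hu, huη⟩ := Hsq (i₀ + 1) (by omega) (by omega)
  have hηne : ((i₀ + 1 : ℕ) : ZMod p) ≠ 0 := by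
    rw [Ne, ZMod.natCast_eq_zero_iff]
    exact Nat.not_dvd_of_pos_of_lt (by omega) (by omega)
  refine ⟨T₁.image (dilate u ((i₀ + 1 : ℕ) : ZMod p)), ?_, PF_dilate hT₁pf huη hu, ?_, ?_, ?_⟩
  · rw [Finset.card_image_of_injective _ (dilate_injective hu hηne), hT₁card]
  · exact Finset.mem_image.2 ⟨(0, 0), hT₁zero, by simp [dilate]⟩
  · intro b
    have hb : b = u * (u⁻¹ * b) := by rw [← mul_assoc, mul_inv_cancel₀ hu, one_mul]
    rw [hb, ccZ_dilate T₁ hu hηne, ← mul_zero u, ccZ_dilate T₁ hu hηne]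
    exact hT₁max _
  · rw [colMask_dilate T₁ hu, ← hA₀, isCanon, List.all_eq_true]
    intro i hi
    rw [List.mem_range] at hi
    rw [decide_eq_true_eq, dil_dil hp0, hi₀eq]
    -- `(i+1) (i₀+1) % p` is again a multiplier in `[1, p)`
    have hnd : ¬ p ∣ (i + 1) * (i₀ + 1) := by
      rw [hp.out.dvd_mul]
      rintro (h | h)
      · exact Nat.not_dvd_of_pos_of_lt (by omega) (by omega) h
      · exact Nat.not_dvd_of_pos_of_lt (by omega) (by omega) h
    have hk : 1 ≤ (i + 1) * (i₀ + 1) % p := by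
      rcases Nat.eq_zero_or_pos ((i + 1) * (i₀ + 1) % p) with h | h
      · exact absurd (Nat.dvd_of_mod_eq_zero h) hnd
      · exact h
    have hk' : (i + 1) * (i₀ + 1) % p < p := Nat.mod_lt _ hp0
    refine Finset.min'_le orb _ (Finset.mem_image.2 ⟨(i + 1) * (i₀ + 1) % p - 1, ?_, ?_⟩)
    · rw [Finset.mem_range]; omega
    · rw [Nat.sub_add_cancel hk]

/-! ## The generic exactness theorem -/

/-- **No parabola-free set of size `K`** (generic in `p`): given the decided facts about the
tables, the square roots, and the search verdicts `refuteM p K m = true` for every possible size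
`m ∈ [1, p]` of a largest column, no parabola-free `T ⊆ ℤ_p × ℤ_p` has `K` points. -/
theorem no_parabolaFree (hp16 : p ≤ 16) {K : ℕ} (hK : 0 < K)
    (Hpc : ∀ m < 2 ^ p, pc p m = (bitsOf p m).length)
    (Hnb : ∀ x < p, ∀ i < p, nbT p x i = nb p x i)
    (Hsq : ∀ η : ℕ, 1 ≤ η → η < p → ∃ u : ZMod p, u ≠ 0 ∧ (u ^ 2 = η ∨ -u ^ 2 = η))
    (Href : ∀ m, 1 ≤ m → m ≤ p → refuteM p K m = true) :
    ¬ ∃ T : Finset (ZMod p × ZMod p), K ≤ T.card ∧ PF T := by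
  have hp0 : 0 < p := hp.out.pos
  rintro ⟨T, hK', hT⟩
  have hne : T.Nonempty := Finset.card_pos.1 (by omega)
  obtain ⟨T₂, hcard, hT₂, hzero, hmax, hcanon⟩ := exists_normalForm Hsq hT hne
  set A := colMask T₂ 0 with hA
  set m := (bitsOf p A).length with hm
  -- `A` is an odd canonical mask of popcount `m ∈ [1, p]`
  have hA0 : A.testBit 0 = true := (testBit_colMask T₂ 0 0).2 ⟨hp0, by simpa using hzero⟩
  have hAodd : A = 2 * (A / 2) + 1 := by
    have h := Nat.testBit_zero A
    rw [hA0] at h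
    have := of_decide_eq_true h.symm
    omega
  have hAlt : A < 2 ^ p := colMask_lt T₂ 0
  have hm1 : 1 ≤ m := by
    rw [hm]
    exact List.length_pos_of_mem (mem_bitsOf.2 ⟨hp0, hA0⟩)
  have hmp : m ≤ p := by
    rw [hm, bitsOf]
    exact (List.filter_sublist.length_le).trans (List.length_range ▸ le_rfl)
  have hmem : A ∈ canonA p m := by
    rw [canonA, List.mem_map]
    refine ⟨A / 2, ?_, by omega⟩
    rw [List.mem_filter, List.mem_range]
    refine ⟨?_, ?_⟩
    · have h2 : 2 ^ (p - 1) * 2 = 2 ^ p := by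
        rw [← pow_succ, Nat.sub_add_cancel hp.out.one_lt.le]
      exact (Nat.div_lt_iff_lt_mul two_pos).2 (h2 ▸ hAlt)
    · rw [← hAodd, Hpc A hAlt, ← hm, hcanon]
      simp
  have htop : topA p K m A = false := by
    have := List.all_eq_true.1 (Href m hm1 hmp) A hmem
    simpa using this
  -- the family of column masks of `T₂` is admissible
  have hccm : ∀ y, y < p → (bitsOf p (colMask T₂ y)).length ≤ m := by
    intro y hy
    rw [← ccZ_eq_length T₂ y, hm, hA, ← ccZ_eq_length T₂ 0, Nat.cast_zero]
    exact hmax _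
  have key := topA_false Hpc hp16 htop (colMask T₂) ?_ (fun y _ hy => hccm y hy) ?_
  · rw [card_eq_col_zero_add T₂, ← hA, ← hm] at hcard
    omega
  · intro y hy1 hyp j hj
    refine ⟨((testBit_colMask T₂ y j).1 hj).1, fun i hi => ?_⟩
    obtain ⟨hip, hiA⟩ := mem_bitsOf.1 hi
    rw [Hnb 0 hp0 i hip]
    exact nb_testBit_false_of_PF hp16 hT₂ hp0 hyp (by omega) hiA hj
  · intro y y' hy1 hyp hy1' hyp' hne i j hi hj
    obtain ⟨hip, -⟩ := (testBit_colMask T₂ y i).1 hi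
    rw [Hnb y hyp i hip]
    exact nb_testBit_false_of_PF hp16 hT₂ hyp hyp' hne hi hj

/-! ## The instance `p = 7`: `α₇ = 10` -/

section Seven

/-- popcount table check at `p = 7` -/
theorem pc_seven : ∀ m < 2 ^ 7, pc 7 m = (bitsOf 7 m).length := by decide +kernel

/-- neighbourhood table check at `p = 7` -/
theorem nbT_seven : ∀ x < 7, ∀ i < 7, nbT 7 x i = nb 7 x i := by decide +kernel

/-- every non-zero residue mod `7` is `±` a non-zero square -/
theorem sq_seven : ∀ η : ℕ, 1 ≤ η → η < 7 → ∃ u : ZMod 7, u ≠ 0 ∧ (u ^ 2 = η ∨ -u ^ 2 = η) := by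
  intro η h1 h7
  interval_cases η <;> decide

/-- the search verdicts at `p = 7`, `K = 11`: no canonical column-0 set of any size `m ∈ [1, 7]`
extends to 11 points (141 search nodes in all; kernel time ≈ 3 s) -/
theorem refuteM_seven : ∀ m, 1 ≤ m → m ≤ 7 → refuteM 7 11 m = true := by
  intro m h1 h7
  interval_cases m <;> decide +kernel

/-- **Exact value `α₇ = 10`** (planner sub-stub `stub_parabolaFreeAt_7_not_11`, siege plan of
stmt-14080, family P2-mod): no parabola-free subset of `ℤ₇ × ℤ₇` has 11 points; with
`stub_parabolaFreeAt_7_10` (`…ParabolaFreeInstances.lean`) the largest parabola-free set, i.e. the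
largest parabola lift with wrap-around over `𝔽₇`, has exactly 10 points (`⌊7^{3/2}⌋ = 18`; the
Hoffman bound of the parabola Cayley graph is 12.9). [computation, kernel `decide`] -/
theorem stub_parabolaFreeAt_7_not_11 : ¬ ∃ T : Finset (ZMod 7 × ZMod 7), 11 ≤ T.card ∧
    ∀ t ∈ T, ∀ t' ∈ T, (t'.1 - t.1) ^ 2 = t.2 - t'.2 → t'.1 = t.1 :=
  no_parabolaFree (p := 7) (hp := ⟨by norm_num⟩) (by norm_num) (by norm_num) pc_seven nbT_seven sq_seven
    refuteM_seven

end Seven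

end Summit.MatrixMultiplication.MatrixMultiplication.Theorems.LevelOneGL2Designs.PFS
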